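/-
Copyright (c) 2026 the pub-hodgecm-mathlib formalisation cell (harness21).  Prover seat hodgecm-mathlib-K2E3-p37 (g2), Track B «K2-LIT» ∕ h413 =
`stmt-HodgeConjecture-24833`, line `K2_E3_EllipticInputs`, unit U4 «Keys», PART «U4Keys» socket :182 (U4f-χ₁-ram-one-pos)
`sig_K2E3KeysThmTwoContractingRamifiedCharOnePosDepth` (L4 line-lead K2E3-plan (g5); regime A_pos^{<} of this base's g0 memo §9, two-depth bricks (i)^{<} ★ D174 p862387
(K2E3-p14 (g9)), (v)-θ^{<} ★ p862449 (K2E3-p34 (g2)) ∕ ★ p862455 (K2E3-p14 (g9))): brick (iii)^{<} «THE DEPTH WITNESSES FOR THE TWO-DEPTH GROUP» — families X and Z of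
★ p862372 re-targeted from the uniform `J_{m+1}` to the concave-exponent group `J_e`, `e = (r, s; r′, s′)`, with the regime carried as monomial valuation inequalities
(exponents free; the cover and the `w`-chart transport are sequels).  REPORT-FIRST 2026-09-04.
-/
import Summits.HodgeConjecture.HodgeConjecture.Theorems.K2E3IwahoriTwoDepthFactorisation   -- ★ D174 p862387 (K2E3-p14 (g9)): the letters `(Jg) (hJg)`, `test_twoDepth_iff`
import Summits.HodgeConjecture.HodgeConjecture.Theorems.K2E3LevelNDepthWitnessTraceOne     -- ★ p862372 (this seat): `familyXT_*`, `familyZT_*`; brings ★ X∕Z (`familyX_y_mul`, `le_of_mul_le_mul_v`), ★ p861919 (entries), ★ p861613 (`exists_upper_of_rel`)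
import HarnessLib

/-!
# K2 ∕ E3 «EllipticInputs», unit U4 «Keys» — (U4f-χ₁-ram-one-pos), regime A_pos^{<}, brick (iii)^{<}: THE DEPTH WITNESSES FOR THE TWO-DEPTH GROUP `J_e`
# «family X (`y = −c∕σx`, `b = −yσy·t`) and family Z (`y = 0`, `b = c·z⁻¹ − c·t·(z⁻¹ + (σz)⁻¹)`) conjugate into `J_e`, `e = (r, s; r′, s′)`, with `(0,0)` entry `(1 + c)(1 + ε)`, `ε ∈ 𝔭^{m+1}`»
# [Roche1998 §3–§4; BruhatTits1972 (6.4.9); Casselman1995 §6.3; Rogawski1990 §1.10]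

Cell hodgecm-mathlib, Track B «K2-LIT», crux item H413 = stmt-HodgeConjecture-24833 (route `HCCMUnconditional`, no route verbs); target BY NAME the OPEN tier-0 leaf
`…K2E3EllipticInputs.U4Keys.sig_K2E3KeysThmTwoContractingRamifiedCharOnePosDepth` (U4Keys ED. 8 :182), design D-I «vanishing functional» at POSITIVE depth, regime A_pos^{<}
(cond_F `χ₁` = `c` < `n` = cond_E `χ₁`: p37 (g0) memo §9 — the uniform `J_n` leaves θ-relevant cells, Roche's asymmetric `J_χ` does not).
Author K2E3-p37 (g2).  `--supports stmt-HodgeConjecture-24833 --as helper`; THEOREMS ONLY; MODEL level.  NOT THE PAYER.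

THE POINT.  `G = P·N̄ ⊔ P·w`, so the `(P, J_e)` double cosets are the `P·ū(x,z)·J_e` (`ū ∈ N̄`) and `P·w·J_e`; the cell-family engine ★ p861573 needs, for every INTERMEDIATE
`ū` (`ū ∉ J_e`, `ū ∉ P·w·J_e`), some `u ∈ N` with `j := ū⁻¹ u ū ∈ J_e` and `θ(j) = χ₁(j₀₀) ≠ 1 = (χδ^{½})(u)`.  The two families of ★ X∕Z (p862033∕p861978; trace-one form
★ p862372) do this for `J_e` exactly as for `J_{m+1}` — only the bookkeeping of the SEVEN entry clauses of ★ D174 `test_twoDepth_iff` (`|j₀₁|, |j₁₂| ≤ |ϖ|ʳ`, `|j₀₂| ≤ |ϖ|ˢ`,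
`|j₁₀|, |j₂₁| ≤ |ϖ|^{r′}`, `|j₂₀| ≤ |ϖ|^{s′}`, integrality) changes.  By ★ p861919 and §1: `j₀₀ = 1 − yσx + bz`, `j₀₁ = y + bx`, `j₀₂ = b`, `j₁₂ = σx·b − σy`,
`j₁₀ = −y(σx)² + σx·bz − σy·z`, `j₂₁ = σz·y + σz·b·x + x²σy`, `j₂₀ = σz·bz + xσy·z − σz·y·σx`.  With `|y||x| = |c|`, `|b| ≤ |y|²` (X) resp. `y = 0`, `|bz| ≤ |c|`,
`|bz − c| ≤ |c||x|²∕|z|` (Z) every clause is a MONOMIAL inequality in `|c|, |x|, |z|, |ϖ|`; this file carries exactly those as hypotheses, so the exponents `(r, s, r′, s′)`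
stay free and the statements serve Roche's `(⌊n∕2⌋, ⌊c∕2⌋, ⌈n∕2⌉, ⌈c∕2⌉)`, its `w`-swap `(r′, s′; r, s)` (chart `P·w·u·J_e` of the non-integral cells), and the uniform `J_n`
(`(0, 0; n, n)`, where they specialise to ★ p862372).
* §1 the three UPPER entries of `j` (★ p861919 gave `(0,0)` and the lower ones).
* §2 **`exists_familyX_witness_twoDepth`** — `X`: any `c` with `|c| ≤ |ϖ|ᵐ`; regime `|ϖ|ᵐ ≤ |ϖ|ʳ|x|` (`|y| ≤ |ϖ|ʳ`), `|ϖ|ᵐ|z| ≤ |ϖ|^{r′}|x|` (`|yz| ≤ |ϖ|^{r′}`),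
  `|ϖ|ᵐ|z| ≤ |ϖ|·|x|²` (`|bz| ≤ |ϖ|^{m+1}`), `r′, s′ ≤ m`, `s ≤ 2r`, `s′ ≤ 2r′`.
* §3 **`exists_familyZ_witness_twoDepth`** — `Z`: `σc = c`, `|c| ≤ |ϖ|ᵏ`, `1 ≤ k`; regime `|ϖ|ᵏ ≤ |ϖ|ˢ|z|` (`|b| ≤ |ϖ|ˢ`), `|ϖ|ᵏ|x| ≤ |ϖ|ʳ|z|` (`|bx| ≤ |ϖ|ʳ`), `|ϖ|ᵏ|x| ≤ |ϖ|^{r′}`,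
  `|ϖ|ᵏ|z| ≤ |ϖ|^{s′}`, `|ϖ|ᵏ|x|² ≤ |ϖ|^{m+1}|z|` (`|bz − c| ≤ |ϖ|^{m+1}`).
In both the conclusion is `∃ u ∈ N, ū⁻¹uū ∈ J_e ∧ ∃ ε, |ε| ≤ |ϖ|^{m+1} ∧ (ū⁻¹uū)₀₀ = (1 + c)(1 + ε)`: `θ(j) = χ₁(1 + c)·χ₁(1 + ε) = χ₁(1 + c)` for cond_E `χ₁ ≤ m + 1` (★ p862449
`chi_apply_zero_zero_mul_of_concave` reads `θ` as `χ₁` of the `(0,0)` entry on `J_e`), `≠ 1` by the exact-conductor letters (`X`: cond_E = `m + 1`; `Z`: cond_F = `k + 1`).  Coverage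
of ALL intermediate cells by `X ∪ Z` for Roche's exponents is the sequel's arithmetic (design line of this seat, K2 bus 2026-09-04).
HONEST LABEL: HC_CM is proved only modulo the 7 printed citations (2 remaining named inputs: hLiu418 = stmt-HodgeConjecture-24832, h413 = stmt-HodgeConjecture-24833)
until rung 0 closes; count-neutral — this file does NOT pay the leaf; no printed citation is discharged.

## References
* [Roche1998] A. Roche, *Types and Hecke algebras for principal series representations of split reductive p-adic groups*, Ann. Sci. ÉNS (4) 31 (1998), §3 (the groups `J_χ`), §4 (support).
* [BruhatTits1972] F. Bruhat, J. Tits, *Groupes réductifs sur un corps local I*, Publ. Math. IHÉS 41 (1972), (6.4.9).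
* [Casselman1995] W. Casselman, *Introduction to the theory of admissible representations of `p`-adic reductive groups* (1995), §6.3.
* [Rogawski1990] J. D. Rogawski, *Automorphic Representations of Unitary Groups in Three Variables*, Ann. of Math. Stud. 123 (1990), §1.9–§1.10 pp. 8–9.
* [Serre1979] J.-P. Serre, *Local Fields*, GTM 67 (1979), Ch. II §1.
-/

set_option autoImplicit false
-- the mandated namespace repeats the single-problem summit's segment (`HodgeConjecture.HodgeConjecture`)
set_option linter.dupNamespace false

noncomputable section

open Matrix Literature.NumberTheory.Automorphic Literature.NumberTheory.Automorphic.UnitaryGroup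
open scoped Matrix MatrixGroups WithZero Pointwise

namespace Summit.HodgeConjecture.HodgeConjecture.Cruxes.H413.K2E3TwoDepthDepthWitness

open Summit.HodgeConjecture.HodgeConjecture.Cruxes.H413
open Summit.HodgeConjecture.HodgeConjecture.Cruxes.H413.K2E3LevelNDepthWitnessZ
open Summit.HodgeConjecture.HodgeConjecture.Cruxes.H413.K2E3LevelNDepthWitnessX
open Summit.HodgeConjecture.HodgeConjecture.Cruxes.H413.K2E3LevelNDepthWitnessTraceOne

/-! ## §1 The three upper entries of `j = ū⁻¹ u ū` -/

section Entries

variable {K : Type*} [Field K] (σ : K →+* K) {J : Matrix (Fin 3) (Fin 3) K} (hJ : J = (StdForm.antidiagonal 3).over K)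
  (hσ : ∀ a, σ (σ a) = a)
  {nb u : ↥(unitaryGroupOfForm σ J)} {x z y b : K}
  (hnb : ((nb : GL (Fin 3) K) : Matrix (Fin 3) (Fin 3) K) = !![1, 0, 0; -σ x, 1, 0; z, x, 1])
  (hu : ((u : GL (Fin 3) K) : Matrix (Fin 3) (Fin 3) K) = !![1, y, b; 0, 1, -σ y; 0, 0, 1])

include hJ hσ hnb hu in
/-- **`j₀₁ = y + b·x`** for `j = ū(x,z)⁻¹ u(y,b) ū(x,z)` (★ `conj_upper_apply`). [cite: Rogawski1990, §1.10 p. 9] -/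
theorem conj_upper_apply_zero_one :
    (((nb⁻¹ * u * nb : ↥(unitaryGroupOfForm σ J)) : GL (Fin 3) K) : Matrix (Fin 3) (Fin 3) K) 0 1 = y + b * x := by
  rw [K2E3LowerUnipotentConjUpperEntries.conj_upper_apply σ hJ hσ hnb hu]
  simp [Matrix.mul_apply, Fin.sum_univ_three]

include hJ hσ hnb hu in
/-- **`j₀₂ = b`**. [cite: Rogawski1990, §1.10 p. 9] -/
theorem conj_upper_apply_zero_two :
    (((nb⁻¹ * u * nb : ↥(unitaryGroupOfForm σ J)) : GL (Fin 3) K) : Matrix (Fin 3) (Fin 3) K) 0 2 = b := by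
  rw [K2E3LowerUnipotentConjUpperEntries.conj_upper_apply σ hJ hσ hnb hu]
  simp [Matrix.mul_apply, Fin.sum_univ_three]

include hJ hσ hnb hu in
/-- **`j₁₂ = σx·b − σy`**. [cite: Rogawski1990, §1.10 p. 9] -/
theorem conj_upper_apply_one_two :
    (((nb⁻¹ * u * nb : ↥(unitaryGroupOfForm σ J)) : GL (Fin 3) K) : Matrix (Fin 3) (Fin 3) K) 1 2 = σ x * b - σ y := by
  rw [K2E3LowerUnipotentConjUpperEntries.conj_upper_apply σ hJ hσ hnb hu]
  simp [Matrix.mul_apply, Fin.sum_univ_three]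
  ring

end Entries

section Valuation

variable {K : Type*} [Field K] [Valued K ℤᵐ⁰] [ValuativeRel K] [(Valued.v : Valuation K ℤᵐ⁰).Compatible]
  (σ : K →+* K) {ϖ : K} {J : Matrix (Fin 3) (Fin 3) K} (hJ : J = (StdForm.antidiagonal 3).over K)
  (hσ : ∀ a, σ (σ a) = a) (hvσ : ∀ a, Valued.v (σ a) = Valued.v a) (hvϖ : Valued.v ϖ = WithZero.exp (-1 : ℤ))
  (r s r' s' : ℕ) (Jg : Subgroup ↥(unitaryGroupOfForm σ J))
  (hJg : ∀ k, k ∈ Jg ↔ ∀ i j, Valued.v (((k : GL (Fin 3) K) : Matrix (Fin 3) (Fin 3) K) i j) ≤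
    Valued.v ϖ ^ (![![0, r, s], ![r', 0, r], ![s', r', 0]] : Fin 3 → Fin 3 → ℕ) i j)

omit [ValuativeRel K] [(Valued.v : Valuation K ℤᵐ⁰).Compatible] in
/-- `|ϖ|ᵃ ≤ |ϖ|ᵇ` for `b ≤ a` (`|ϖ| ≤ 1`). [cite: Serre1979, Ch. II §1] -/
theorem v_pow_le_pow (hvϖ1 : Valued.v ϖ ≤ 1) {a b : ℕ} (h : b ≤ a) : Valued.v ϖ ^ a ≤ Valued.v ϖ ^ b :=
  pow_le_pow_right_of_le_one' hvϖ1 h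

/-! ## §2 Family X on the two-depth group -/

include hJ hσ hvσ hvϖ hJg in
set_option maxHeartbeats 1600000 in
-- one `u ∈ N`, seven entries, a dozen valuation bounds (as ★ X)
/-- **FAMILY X ON `J_e`.**  `ū ∈ U(σ, Φ₃)` with matrix `ū(x, z)` (`z + σz + xσx = 0`, `|x|, |z| ≤ 1`); ANY `c` with `|c| ≤ |ϖ|ᵐ` (`1 ≤ m`); a trace-one `t` (`t + σt = 1`, `|t| ≤ 1`);
regime `|ϖ|ᵐ ≤ |ϖ|ʳ·|x|`, `|ϖ|ᵐ·|z| ≤ |ϖ|^{r′}·|x|`, `|ϖ|ᵐ·|z| ≤ |ϖ|·|x|²`; exponents `r′ ≤ m`, `s′ ≤ m`, `s ≤ 2r`, `s′ ≤ 2r′`.  Then `u := u(y, b)` with `y = −c∕σx`, `b = −yσy·t`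
lies in `N`, `ū⁻¹ u ū ∈ J_e` (the two-depth group of ★ D174, letters `(Jg, hJg)`), and `(ū⁻¹ u ū)₀₀ = (1 + c)(1 + ε)` with `|ε| ≤ |ϖ|^{m+1}`.  At `(r, s, r′, s′) = (0, 0, m+1, m+1)`
(up to the spelling of `J_{m+1}`) this is ★ p862372 `exists_familyX_witness_of_traceOne`. [cite: Roche1998, §3–§4] [cite: Casselman1995, §6.3] [cite: Rogawski1990, §1.10 p. 9] -/
theorem exists_familyX_witness_twoDepth {m : ℕ} (hm : 1 ≤ m) {nb : ↥(unitaryGroupOfForm σ J)} {x z c t : K}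
    (hnb : ((nb : GL (Fin 3) K) : Matrix (Fin 3) (Fin 3) K) = !![1, 0, 0; -σ x, 1, 0; z, x, 1]) (hrel : z + σ z + x * σ x = 0)
    (hx1 : Valued.v x ≤ 1) (hz1 : Valued.v z ≤ 1)
    (hxr : Valued.v ϖ ^ m ≤ Valued.v ϖ ^ r * Valued.v x) (hzx : Valued.v ϖ ^ m * Valued.v z ≤ Valued.v ϖ ^ r' * Valued.v x)
    (hz2 : Valued.v ϖ ^ m * Valued.v z ≤ Valued.v ϖ * (Valued.v x * Valued.v x))
    (hr'm : r' ≤ m) (hs'm : s' ≤ m) (hs : s ≤ 2 * r) (hs' : s' ≤ 2 * r')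
    (hc : Valued.v c ≤ Valued.v ϖ ^ m) (ht : t + σ t = 1) (hvt : Valued.v t ≤ 1) :
    ∃ u : ↥(unitaryGroupOfForm σ J), u ∈ unipotentU σ J ∧ nb⁻¹ * u * nb ∈ Jg ∧
      ∃ ε : K, Valued.v ε ≤ Valued.v ϖ ^ (m + 1) ∧
        (((nb⁻¹ * u * nb : ↥(unitaryGroupOfForm σ J)) : GL (Fin 3) K) : Matrix (Fin 3) (Fin 3) K) 0 0 = (1 + c) * (1 + ε) := by
  have hϖ0 : ϖ ≠ 0 := CartanUnique.uniformizer_ne_zero hvϖ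
  have hvϖ0 : Valued.v ϖ ≠ 0 := (Valuation.ne_zero_iff _).2 hϖ0
  have hvϖ1 : Valued.v ϖ ≤ 1 := by rw [hvϖ, ← WithZero.exp_zero, WithZero.exp_le_exp]; norm_num
  have hvϖlt : Valued.v ϖ < 1 := by rw [hvϖ, ← WithZero.exp_zero, WithZero.exp_lt_exp]; norm_num
  have hvϖmlt : Valued.v ϖ ^ m < 1 := pow_lt_one' hvϖlt (Nat.one_le_iff_ne_zero.1 hm)
  have hx0 : x ≠ 0 := fun h => by
    rw [h, map_zero, mul_zero] at hxr
    exact absurd hxr (not_le.2 (pow_pos (zero_lt_iff.2 hvϖ0) m))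
  have hvx0 : Valued.v x ≠ 0 := (Valuation.ne_zero_iff _).2 hx0
  have hσx : σ x ≠ 0 := (map_ne_zero σ).2 hx0
  -- powers of `|ϖ|`
  have hPr : Valued.v ϖ ^ r ≤ 1 := pow_le_one' hvϖ1 r
  have hP2r_s : Valued.v ϖ ^ r * Valued.v ϖ ^ r ≤ Valued.v ϖ ^ s := by rw [← pow_add]; exact v_pow_le_pow hvϖ1 (by omega)
  have hP2r'_s' : Valued.v ϖ ^ r' * Valued.v ϖ ^ r' ≤ Valued.v ϖ ^ s' := by rw [← pow_add]; exact v_pow_le_pow hvϖ1 (by omega)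
  have hPm_r' : Valued.v ϖ ^ m ≤ Valued.v ϖ ^ r' := v_pow_le_pow hvϖ1 hr'm
  have hPm_s' : Valued.v ϖ ^ m ≤ Valued.v ϖ ^ s' := v_pow_le_pow hvϖ1 hs'm
  -- the element `u = u(y, b)`
  obtain ⟨y, hy⟩ : ∃ y : K, y = -c / σ x := ⟨_, rfl⟩
  obtain ⟨b, hb⟩ : ∃ b : K, b = -(y * σ y) * t := ⟨_, rfl⟩
  obtain ⟨u, huN, hu⟩ := K2E3LowerUnipotentBigCellIntegral.exists_upper_of_rel σ hJ hσ (a := y) (b := b) (familyXT_rel σ hσ ht hb)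
  obtain ⟨hyx, hvb⟩ := familyXT_v_y_mul σ hvσ hy hb hx0 hvt
  have hyc : y * σ x = -c := familyX_y_mul σ hy hσx
  -- `|y| ≤ |ϖ|ʳ ≤ 1`: `|y||x| = |c| ≤ |ϖ|ᵐ ≤ |ϖ|ʳ|x|`
  have hvyr : Valued.v y ≤ Valued.v ϖ ^ r := by
    refine le_of_mul_le_mul_v (C := Valued.v x) ?_ hvx0
    rw [hyx]; exact hc.trans hxr
  have hvy : Valued.v y ≤ 1 := hvyr.trans hPr
  have hvσy : Valued.v (σ y) ≤ 1 := by rw [hvσ]; exact hvy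
  -- `|b| ≤ |y|² ≤ |ϖ|ˢ`, `|b| ≤ |y|`, `|b| ≤ 1`
  have hvbs : Valued.v b ≤ Valued.v ϖ ^ s := hvb.trans ((mul_le_mul' hvyr hvyr).trans hP2r_s)
  have hvby : Valued.v b ≤ Valued.v y := hvb.trans ((mul_le_mul' hvy le_rfl).trans_eq (one_mul _))
  have hvb1 : Valued.v b ≤ 1 := hvby.trans hvy
  -- `|y|·|z| ≤ |ϖ|^{r′}`: `|y||z||x| = |c||z| ≤ |ϖ|ᵐ|z| ≤ |ϖ|^{r′}|x|`
  have hvyz : Valued.v y * Valued.v z ≤ Valued.v ϖ ^ r' := by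
    refine le_of_mul_le_mul_v (C := Valued.v x) ?_ hvx0
    calc Valued.v y * Valued.v z * Valued.v x = Valued.v y * Valued.v x * Valued.v z := mul_right_comm _ _ _
      _ = Valued.v c * Valued.v z := by rw [hyx]
      _ ≤ Valued.v ϖ ^ m * Valued.v z := mul_le_mul' hc le_rfl
      _ ≤ Valued.v ϖ ^ r' * Valued.v x := hzx
  -- `|c|·|x| ≤ |ϖ|^{r′}`, `|c|·|z| ≤ |ϖ|^{s′}`, `|c| ≤ 1`
  have hvc1 : Valued.v c ≤ 1 := hc.trans (pow_le_one' hvϖ1 m)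
  have hcx : Valued.v c * Valued.v x ≤ Valued.v ϖ ^ r' := (mul_le_mul' (hc.trans hPm_r') hx1).trans_eq (mul_one _)
  have hcz : Valued.v c * Valued.v z ≤ Valued.v ϖ ^ s' := (mul_le_mul' (hc.trans hPm_s') hz1).trans_eq (mul_one _)
  -- `|b z| ≤ |y|²|z| ≤ |ϖ|^{m+1}`: `|c|²|z| ≤ |ϖ|^{2m}|z| ≤ |ϖ|^{m+1}|x|²`
  have hbz : Valued.v (b * z) ≤ Valued.v ϖ ^ (m + 1) := by
    refine le_of_mul_le_mul_v (C := Valued.v x * Valued.v x) ?_ (mul_ne_zero hvx0 hvx0)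
    calc Valued.v (b * z) * (Valued.v x * Valued.v x) = Valued.v b * (Valued.v x * Valued.v x) * Valued.v z := by
          rw [map_mul]; simp only [mul_comm, mul_left_comm]
      _ ≤ Valued.v y * Valued.v y * (Valued.v x * Valued.v x) * Valued.v z := mul_le_mul' (mul_le_mul' hvb le_rfl) le_rfl
      _ = Valued.v y * Valued.v x * (Valued.v y * Valued.v x) * Valued.v z := by simp only [mul_comm, mul_left_comm]
      _ = Valued.v c * (Valued.v c * Valued.v z) := by rw [hyx, mul_assoc]
      _ ≤ Valued.v ϖ ^ m * (Valued.v ϖ ^ m * Valued.v z) := mul_le_mul' hc (mul_le_mul' hc le_rfl)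
      _ ≤ Valued.v ϖ ^ m * (Valued.v ϖ * (Valued.v x * Valued.v x)) := mul_le_mul' le_rfl hz2
      _ = Valued.v ϖ ^ (m + 1) * (Valued.v x * Valued.v x) := by rw [pow_succ]; simp only [mul_assoc]
  -- the seven entries: bounds on the monomials
  have e01 := conj_upper_apply_zero_one σ hJ hσ hnb hu
  have e02 := conj_upper_apply_zero_two σ hJ hσ hnb hu
  have e12 := conj_upper_apply_one_two σ hJ hσ hnb hu
  have e00 := K2E3LowerUnipotentConjUpperEntries.conj_upper_apply_zero_zero_of_familyX σ hJ hσ hnb hu hyc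
  have e10 := K2E3LowerUnipotentConjUpperEntries.conj_upper_apply_one_zero σ hJ hσ hnb hu
  have e20 := K2E3LowerUnipotentConjUpperEntries.conj_upper_apply_two_zero σ hJ hσ hnb hu hrel
  have e21 := K2E3LowerUnipotentConjUpperEntries.conj_upper_apply_two_one σ hJ hσ hnb hu
  -- `|bx| ≤ |y|` (hence `≤ |ϖ|ʳ`): `|b||x| ≤ |y|²|x| = |y||c| ≤ |y|`
  have hbx : Valued.v (b * x) ≤ Valued.v ϖ ^ r := by
    rw [map_mul]
    calc Valued.v b * Valued.v x ≤ Valued.v y * Valued.v y * Valued.v x := mul_le_mul' hvb le_rfl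
      _ = Valued.v y * Valued.v c := by rw [mul_assoc, hyx]
      _ ≤ Valued.v y * 1 := mul_le_mul' le_rfl hvc1
      _ ≤ Valued.v ϖ ^ r := by rw [mul_one]; exact hvyr
  have hxb : Valued.v (σ x * b) ≤ Valued.v ϖ ^ r := by rw [map_mul, hvσ, mul_comm, ← map_mul]; exact hbx
  -- lower monomials
  have hyxx : Valued.v (y * σ x * σ x) ≤ Valued.v ϖ ^ r' := by
    rw [map_mul, map_mul, hvσ, hyx]; exact hcx
  have hxbz : Valued.v (σ x * b * z) ≤ Valued.v ϖ ^ r' := by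
    rw [mul_assoc, map_mul, hvσ]
    exact (mul_le_mul' hx1 (hbz.trans (v_pow_le_pow hvϖ1 (by omega)))).trans_eq (one_mul _)
  have hyz : Valued.v (σ y * z) ≤ Valued.v ϖ ^ r' := by rw [map_mul, hvσ]; exact hvyz
  have hzy : Valued.v (σ z * y) ≤ Valued.v ϖ ^ r' := by rw [map_mul, hvσ, mul_comm]; exact hvyz
  have hzbx : Valued.v (σ z * b * x) ≤ Valued.v ϖ ^ r' := by
    -- `|z||b||x| ≤ |z|·|y|²·|x| = (|y||z|)·|c| ≤ |ϖ|^{r′}`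
    rw [map_mul, map_mul, hvσ]
    calc Valued.v z * Valued.v b * Valued.v x ≤ Valued.v z * (Valued.v y * Valued.v y) * Valued.v x := mul_le_mul' (mul_le_mul' le_rfl hvb) le_rfl
      _ = Valued.v y * Valued.v z * (Valued.v y * Valued.v x) := by simp only [mul_comm, mul_left_comm]
      _ ≤ Valued.v ϖ ^ r' * 1 := by rw [hyx]; exact mul_le_mul' hvyz hvc1
      _ = Valued.v ϖ ^ r' := mul_one _
  have hxxy : Valued.v (x * x * σ y) ≤ Valued.v ϖ ^ r' := by
    rw [show x * x * σ y = (σ y * x) * x by ring, map_mul, map_mul, hvσ, hyx]; exact hcx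
  have hzbz : Valued.v (σ z * b * z) ≤ Valued.v ϖ ^ s' := by
    -- `|z|²|b| ≤ (|y||z|)² ≤ |ϖ|^{2r′} ≤ |ϖ|^{s′}`
    rw [map_mul, map_mul, hvσ]
    calc Valued.v z * Valued.v b * Valued.v z ≤ Valued.v z * (Valued.v y * Valued.v y) * Valued.v z := mul_le_mul' (mul_le_mul' le_rfl hvb) le_rfl
      _ = (Valued.v y * Valued.v z) * (Valued.v y * Valued.v z) := by simp only [mul_comm, mul_left_comm]
      _ ≤ Valued.v ϖ ^ r' * Valued.v ϖ ^ r' := mul_le_mul' hvyz hvyz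
      _ ≤ Valued.v ϖ ^ s' := hP2r'_s'
  have hxyz : Valued.v (x * σ y * z) ≤ Valued.v ϖ ^ s' := by
    rw [show x * σ y * z = (σ y * x) * z by ring, map_mul, map_mul, hvσ, hyx]; exact hcz
  have hzyx : Valued.v (σ z * y * σ x) ≤ Valued.v ϖ ^ s' := by
    rw [show σ z * y * σ x = σ z * (y * σ x) by ring, hyc, map_mul, Valuation.map_neg, hvσ, mul_comm]; exact hcz
  -- `u`, `ū`, hence `j`, integral
  have huK : (u : GL (Fin 3) K) ∈ glInt 3 K := mem_glInt_of_coe_eq σ hJ hvσ hu fun i j => by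
    fin_cases i <;> fin_cases j <;> simp [hvb1, hvy, hvσy]
  have hnbK : (nb : GL (Fin 3) K) ∈ glInt 3 K := mem_glInt_of_coe_eq_lower σ hJ hvσ hnb hx1 hz1
  have hjK : nb⁻¹ * u * nb ∈ (glInt 3 K).subgroupOf (unitaryGroupOfForm σ J) :=
    Subgroup.mul_mem _ (Subgroup.mul_mem _ (Subgroup.inv_mem _ (Subgroup.mem_subgroupOf.2 hnbK)) (Subgroup.mem_subgroupOf.2 huK))
      (Subgroup.mem_subgroupOf.2 hnbK)
  refine ⟨u, huN, ?_, ?_⟩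
  · rw [hJg, K2E3IwahoriTwoDepthFactorisation.test_twoDepth_iff σ hvϖ1 r s r' s']
    refine ⟨(mem_glInt_subgroupOf_iff σ hJ hvσ _).1 hjK, ?_, ?_, ?_, ?_, ?_, ?_⟩
    · rw [e01]; exact Valued.v.map_add_le hvyr hbx
    · rw [e12]; refine Valued.v.map_sub_le hxb ?_; rw [hvσ]; exact hvyr
    · rw [e02]; exact hvbs
    · rw [e10]
      refine Valued.v.map_sub_le (Valued.v.map_add_le ?_ hxbz) hyz
      rw [Valuation.map_neg]; exact hyxx
    · rw [e21]; exact Valued.v.map_add_le (Valued.v.map_add_le hzy hzbx) hxxy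
    · rw [e20]; exact Valued.v.map_sub_le (Valued.v.map_add_le hzbz hxyz) hzyx
  · have hclt : Valued.v c < Valued.v (1 : K) := by rw [Valuation.map_one]; exact lt_of_le_of_lt hc hvϖmlt
    have h1c : Valued.v (1 + c) = 1 := by rw [Valuation.map_add_eq_of_lt_left _ hclt, Valuation.map_one]
    have h1c0 : (1 + c : K) ≠ 0 := fun h => by rw [h, map_zero] at h1c; exact zero_ne_one h1c
    refine ⟨b * z / (1 + c), ?_, ?_⟩
    · rw [map_div₀, h1c, div_one]; exact hbz
    · rw [e00]
      field_simp

/-! ## §3 Family Z on the two-depth group -/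

include hJ hσ hvσ hvϖ hJg in
set_option maxHeartbeats 800000 in
-- one `u ∈ N`, seven entries, six valuation bounds (as ★ Z)
/-- **FAMILY Z ON `J_e`.**  `ū ∈ U(σ, Φ₃)` with matrix `ū(x, z)` (`z + σz + xσx = 0`, `|x|, |z| ≤ 1`); `c` with `σc = c`, `|c| ≤ |ϖ|ᵏ` (`1 ≤ k`); a trace-one `t`; regime
`|ϖ|ᵏ ≤ |ϖ|ˢ·|z|` (`|b| ≤ |ϖ|ˢ`, `z ≠ 0`), `|ϖ|ᵏ·|x| ≤ |ϖ|ʳ·|z|` (`|bx| ≤ |ϖ|ʳ`), `|ϖ|ᵏ·|x| ≤ |ϖ|^{r′}`, `|ϖ|ᵏ·|z| ≤ |ϖ|^{s′}`, `|ϖ|ᵏ·|x|² ≤ |ϖ|^{m+1}·|z|`.  Then `u := u(0, b)`,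
`b = c·z⁻¹ − c·t·(z⁻¹ + (σz)⁻¹)`, lies in `N`, `ū⁻¹ u ū ∈ J_e`, and `(ū⁻¹ u ū)₀₀ = (1 + c)(1 + ε)` with `|ε| ≤ |ϖ|^{m+1}` (`bz·σz = c·σz + c·t·xσx`, ★ p862372: `|bz| ≤ |c|`,
`|bz − c| ≤ |c||x|²∕|z|`).  At `(r, s, r′, s′) = (0, 0, m+1, m+1)`, `k = m` this is ★ p862372 `exists_familyZ_witness_of_traceOne`.
[cite: Roche1998, §3–§4] [cite: Casselman1995, §6.3] [cite: Rogawski1990, §1.10 p. 9] -/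
theorem exists_familyZ_witness_twoDepth {k m : ℕ} (hk : 1 ≤ k) {nb : ↥(unitaryGroupOfForm σ J)} {x z c t : K}
    (hnb : ((nb : GL (Fin 3) K) : Matrix (Fin 3) (Fin 3) K) = !![1, 0, 0; -σ x, 1, 0; z, x, 1]) (hrel : z + σ z + x * σ x = 0)
    (hx1 : Valued.v x ≤ 1) (hz1 : Valued.v z ≤ 1)
    (hzs : Valued.v ϖ ^ k ≤ Valued.v ϖ ^ s * Valued.v z) (hxzr : Valued.v ϖ ^ k * Valued.v x ≤ Valued.v ϖ ^ r * Valued.v z)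
    (hxr' : Valued.v ϖ ^ k * Valued.v x ≤ Valued.v ϖ ^ r') (hzs' : Valued.v ϖ ^ k * Valued.v z ≤ Valued.v ϖ ^ s')
    (hε : Valued.v ϖ ^ k * (Valued.v x * Valued.v x) ≤ Valued.v ϖ ^ (m + 1) * Valued.v z)
    (hσc : σ c = c) (hc : Valued.v c ≤ Valued.v ϖ ^ k) (ht : t + σ t = 1) (hvt : Valued.v t ≤ 1) :
    ∃ u : ↥(unitaryGroupOfForm σ J), u ∈ unipotentU σ J ∧ nb⁻¹ * u * nb ∈ Jg ∧
      ∃ ε : K, Valued.v ε ≤ Valued.v ϖ ^ (m + 1) ∧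
        (((nb⁻¹ * u * nb : ↥(unitaryGroupOfForm σ J)) : GL (Fin 3) K) : Matrix (Fin 3) (Fin 3) K) 0 0 = (1 + c) * (1 + ε) := by
  have hϖ0 : ϖ ≠ 0 := CartanUnique.uniformizer_ne_zero hvϖ
  have hvϖ0 : Valued.v ϖ ≠ 0 := (Valuation.ne_zero_iff _).2 hϖ0
  have hvϖ1 : Valued.v ϖ ≤ 1 := by rw [hvϖ, ← WithZero.exp_zero, WithZero.exp_le_exp]; norm_num
  have hvϖlt : Valued.v ϖ < 1 := by rw [hvϖ, ← WithZero.exp_zero, WithZero.exp_lt_exp]; norm_num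
  have hvϖklt : Valued.v ϖ ^ k < 1 := pow_lt_one' hvϖlt (Nat.one_le_iff_ne_zero.1 hk)
  have hz : z ≠ 0 := fun h => by
    rw [h, map_zero, mul_zero] at hzs
    exact absurd hzs (not_le.2 (pow_pos (zero_lt_iff.2 hvϖ0) k))
  have hvz0 : Valued.v z ≠ 0 := (Valuation.ne_zero_iff _).2 hz
  have hσz : σ z ≠ 0 := (map_ne_zero σ).2 hz
  -- `|x|² ≤ |z|` from the relation
  have hxx : Valued.v x * Valued.v x ≤ Valued.v z := v_mul_v_le_of_rel σ hvσ hrel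
  -- the element `u = u(0, b)`
  obtain ⟨b, hb⟩ : ∃ b : K, b = c * z⁻¹ - c * t * (z⁻¹ + (σ z)⁻¹) := ⟨_, rfl⟩
  obtain ⟨u, huN, hu⟩ := K2E3LowerUnipotentBigCellIntegral.exists_upper_of_rel σ hJ hσ (a := 0) (b := b) (familyZT_rel σ hσ hσc ht hb)
  -- `|bz| ≤ |c| ≤ |ϖ|ᵏ`: `|bz|·|z| = |c·σz + c·t·xσx| ≤ |c|·|z|`
  have hvbz : Valued.v (b * z) ≤ Valued.v ϖ ^ k := by
    have key := congrArg Valued.v (familyZT_mul_eq σ hrel hz hσz hb)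
    rw [map_mul Valued.v (b * z) (σ z), hvσ] at key
    have hR : Valued.v (c * σ z + c * t * (x * σ x)) ≤ Valued.v c * Valued.v z := by
      refine Valued.v.map_add_le ?_ ?_
      · rw [map_mul, hvσ]
      · rw [map_mul, map_mul, map_mul, hvσ, mul_assoc]
        refine mul_le_mul' le_rfl ?_
        exact (mul_le_mul' hvt hxx).trans_eq (one_mul _)
    rw [← key] at hR
    exact (le_of_mul_le_mul_v hR hvz0).trans hc
  -- `|bz − c| ≤ |ϖ|^{m+1}`: `|bz − c|·|z| = |c|·|t|·|x|² ≤ |ϖ|ᵏ|x|² ≤ |ϖ|^{m+1}|z|`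
  have hvsub : Valued.v (b * z - c) ≤ Valued.v ϖ ^ (m + 1) := by
    have key := congrArg Valued.v (familyZT_sub_mul_eq σ hrel hz hσz hb)
    rw [map_mul Valued.v (b * z - c) (σ z), hvσ, map_mul Valued.v (c * t) (x * σ x), map_mul Valued.v c t, map_mul Valued.v x (σ x), hvσ] at key
    have h : Valued.v (b * z - c) * Valued.v z ≤ Valued.v ϖ ^ (m + 1) * Valued.v z := by
      rw [key]
      calc Valued.v c * Valued.v t * (Valued.v x * Valued.v x) ≤ Valued.v ϖ ^ k * 1 * (Valued.v x * Valued.v x) :=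
            mul_le_mul' (mul_le_mul' hc hvt) le_rfl
        _ = Valued.v ϖ ^ k * (Valued.v x * Valued.v x) := by rw [mul_one]
        _ ≤ Valued.v ϖ ^ (m + 1) * Valued.v z := hε
    exact le_of_mul_le_mul_v h hvz0
  -- `|b| ≤ |ϖ|ˢ ≤ 1`: `|b|·|z| ≤ |ϖ|ᵏ ≤ |ϖ|ˢ|z|`
  have hvbs : Valued.v b ≤ Valued.v ϖ ^ s := by
    refine le_of_mul_le_mul_v (C := Valued.v z) ?_ hvz0
    rw [← map_mul]; exact hvbz.trans hzs
  have hvb : Valued.v b ≤ 1 := hvbs.trans (pow_le_one' hvϖ1 s)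
  -- `u`, `ū`, hence `j = ū⁻¹ u ū`, are integral
  have huK : (u : GL (Fin 3) K) ∈ glInt 3 K := mem_glInt_of_coe_eq σ hJ hvσ hu fun i j => by
    fin_cases i <;> fin_cases j <;> simp [hvb]
  have hnbK : (nb : GL (Fin 3) K) ∈ glInt 3 K := mem_glInt_of_coe_eq_lower σ hJ hvσ hnb hx1 hz1
  have hjK : nb⁻¹ * u * nb ∈ (glInt 3 K).subgroupOf (unitaryGroupOfForm σ J) :=
    Subgroup.mul_mem _ (Subgroup.mul_mem _ (Subgroup.inv_mem _ (Subgroup.mem_subgroupOf.2 hnbK)) (Subgroup.mem_subgroupOf.2 huK))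
      (Subgroup.mem_subgroupOf.2 hnbK)
  -- the entries (`y = 0`)
  obtain ⟨e00, e10, e20, e21⟩ := K2E3LowerUnipotentConjUpperEntries.conj_upper_entries_of_y_eq_zero σ hJ hσ hnb hu hrel rfl
  have e01 := conj_upper_apply_zero_one σ hJ hσ hnb hu
  have e02 := conj_upper_apply_zero_two σ hJ hσ hnb hu
  have e12 := conj_upper_apply_one_two σ hJ hσ hnb hu
  -- the monomials
  have hbx : Valued.v (b * x) ≤ Valued.v ϖ ^ r := by
    -- `|b||x|·|z| = |bz|·|x| ≤ |ϖ|ᵏ|x| ≤ |ϖ|ʳ|z|`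
    refine le_of_mul_le_mul_v (C := Valued.v z) ?_ hvz0
    calc Valued.v (b * x) * Valued.v z = Valued.v (b * z) * Valued.v x := by rw [map_mul, map_mul]; exact mul_right_comm _ _ _
      _ ≤ Valued.v ϖ ^ k * Valued.v x := mul_le_mul' hvbz le_rfl
      _ ≤ Valued.v ϖ ^ r * Valued.v z := hxzr
  have hxb : Valued.v (σ x * b) ≤ Valued.v ϖ ^ r := by rw [map_mul, hvσ, mul_comm, ← map_mul]; exact hbx
  have hxbz : Valued.v (σ x * b * z) ≤ Valued.v ϖ ^ r' := by
    rw [mul_assoc, map_mul, hvσ, mul_comm]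
    exact (mul_le_mul' hvbz le_rfl).trans hxr'
  have hzbx : Valued.v (σ z * b * x) ≤ Valued.v ϖ ^ r' := by
    rw [show σ z * b * x = (b * σ z) * x by ring, map_mul, map_mul, hvσ, ← map_mul]
    exact (mul_le_mul' hvbz le_rfl).trans hxr'
  have hzbz : Valued.v (σ z * b * z) ≤ Valued.v ϖ ^ s' := by
    rw [show σ z * b * z = (b * z) * σ z by ring, map_mul, hvσ]
    exact (mul_le_mul' hvbz le_rfl).trans hzs'
  refine ⟨u, huN, ?_, ?_⟩
  · rw [hJg, K2E3IwahoriTwoDepthFactorisation.test_twoDepth_iff σ hvϖ1 r s r' s']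
    refine ⟨(mem_glInt_subgroupOf_iff σ hJ hvσ _).1 hjK, ?_, ?_, ?_, ?_, ?_, ?_⟩
    · rw [e01, zero_add]; exact hbx
    · rw [e12, map_zero, sub_zero]; exact hxb
    · rw [e02]; exact hvbs
    · rw [e10]; exact hxbz
    · rw [e21]; exact hzbx
    · rw [e20]; exact hzbz
  · have hclt : Valued.v c < Valued.v (1 : K) := by rw [Valuation.map_one]; exact lt_of_le_of_lt hc hvϖklt
    have h1c : Valued.v (1 + c) = 1 := by rw [Valuation.map_add_eq_of_lt_left _ hclt, Valuation.map_one]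
    have h1c0 : (1 + c : K) ≠ 0 := fun h => by rw [h, map_zero] at h1c; exact zero_ne_one h1c
    refine ⟨(b * z - c) / (1 + c), ?_, ?_⟩
    · rw [map_div₀, h1c, div_one]; exact hvsub
    · rw [e00]
      field_simp
      ring

end Valuation

end Summit.HodgeConjecture.HodgeConjecture.Cruxes.H413.K2E3TwoDepthDepthWitness

end
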